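import Mathlib
import Summits.KontsevichZagierPeriods.Zeta5Search.ClassExpBoundProof
import HarnessLib

/-!
# ζ(5) search — LEMMA V1′ (`ClassExpRigidity`): the extremal classes of the `V`-floor mechanism are RIGID

Cell `pub-zeta5` (HONEST FRAMING: systematic search; no irrationality claim unless certified), typer seat
generation 9.  Discharges BY NAME gen-2 g8's rigidity statement `ClassExpRigidity` of `Zeta5Search/ClusterValuationPairs.lean`
§3b (REPORT-gen2-g8 §2.2, Lemma V1′; exact check there: equality `E_x = −(N_p+1)` in 238 of 18,695 multipole classes, always a
two-point class of shape `(−1,−1)` with `N_p = 1` or `(−2,−2)` with `N_p = 3`, never self-conjugate):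

* `classExpRigidity_holds : ClassExpRigidity`.

PROOF.  Typer g8's proof of Lemma V1 (`classExpLowerBound_holds`) is a chain of five inequalities
`E_x ≥ #class − Σ_j nB j` (the centre terms are `≥ 0`), `nB j₁ ≤ #class`, `nB k ≤ bound k` for `k ≠ j₁` (floor facts (F1)/(F2)),
`Σ_{k ≠ j₁} bound k = 1 + star(j₂) + star(j₁)` and `two stars ≤ N_p`; equality `E_x = −(N_p+1)` makes every link tight.
Tightness of (F1) at `(j₁,j₂)` gives `nB j₁ = nB j₂ = #class = N_{j₁j₂} + 1`; a third met block `k` forces `N_{j₁k} = 1`,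
`nB k = #class` and, by (F1) at `(j₁,k)`, `#class = 2`, and two third blocks are incompatible with the vanishing of the remaining
pair floors; with no third met block, `N_{j₁k} = 0` for some `k` and the polytope inequality `2b_k ≤ b₀` bound the span of the
class by `b₀ − 2b_{j₁} < 2p`, so again `#class = 2`.  The vanishing centre terms exclude self-conjugacy.  Integer bookkeeping
only (`p` odd, `p ≥ 1`, the polytope); nothing about irrationality.
-/

noncomputable section

open Finset

namespace Summit.KontsevichZagierPeriods.Zeta5Search.ClusterValuation

open Summit.KontsevichZagierPeriods.Zeta5Search.DualSeries (InBox)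
open Summit.KontsevichZagierPeriods.Zeta5Search.CasoratianValuation (InPolytope pairFloors)

/-! ### The exact form of the class exponent -/

/-- **`E_x = #class − Σ_j nB j + #{even centre in the class} + [odd centre in the class]`** (the equality behind
`classExp_ge_card_sub`). -/
theorem classExp_eq_card_sub (b : ℕ → ℤ) (p x : ℕ) :
    classExp b p x = ((classSet b p x).card : ℤ) - ∑ j ∈ range 7, (nB b p x j : ℤ)
      + (((classSet b p x).filter fun s : ℕ => 2 * (s : ℤ) = b 0).card : ℤ)
      + (if ¬ (2 : ℤ) ∣ b 0 ∧ CentreIn b p x then 1 else 0) := by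
  unfold classExp
  rw [← sum_blockCount_eq]
  have h1 : ∑ s ∈ classSet b p x, netExp b s =
      ∑ s ∈ classSet b p x, ((1 - (blockCount b s : ℤ)) + (if 2 * (s : ℤ) = b 0 then 1 else 0)) :=
    sum_congr rfl fun s _ => rfl
  rw [h1, sum_add_distrib, sum_sub_distrib, sum_const, nsmul_eq_mul, mul_one, sum_boole]

/-! ### Small helpers -/

/-- If `nB j = #class` then every class point lies in `B_j`. -/
theorem mem_blk_of_nB_eq_card (b : ℕ → ℤ) {p x j : ℕ} (h : nB b p x j = (classSet b p x).card) :
    ∀ q ∈ classSet b p x, q ∈ blk b j := by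
  have hsub : (classSet b p x).filter (fun s => s ∈ blk b j) ⊆ classSet b p x := filter_subset _ _
  have heq := eq_of_subset_of_card_le hsub (by unfold nB at h; omega)
  intro q hq
  rw [← heq] at hq
  exact (mem_filter.1 hq).2

/-- If `nB j = 0` then no class point lies in `B_j`. -/
theorem not_mem_blk_of_nB_eq_zero (b : ℕ → ℤ) {p x j : ℕ} (h : nB b p x j = 0) :
    ∀ q ∈ classSet b p x, q ∉ blk b j := by
  intro q hq hqj
  unfold nB at h
  rw [card_eq_zero] at h
  have : q ∈ (classSet b p x).filter (fun s => s ∈ blk b j) := mem_filter.2 ⟨hq, hqj⟩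
  rw [h] at this
  exact notMem_empty _ this

/-- `⌊a/p⌋ = 0` with `0 ≤ a` forces `a < p` (`p > 0`). -/
theorem lt_of_ediv_eq_zero {a : ℤ} {p : ℕ} (hp : 0 < p) (h : a / (p : ℤ) = 0) : a < p := by
  have h1 : a / (p : ℤ) < 1 := by rw [h]; norm_num
  have := (Int.ediv_lt_iff_lt_mul (by exact_mod_cast hp)).1 h1
  linarith

/-! ### Lemma V1′ -/

/-- **`ClassExpRigidity` (Lemma V1′) is a theorem.** -/
theorem classExpRigidity_holds : ClassExpRigidity := by
  intro b p x hb hp5 hodd hpb _hwin hx hcount hE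
  have hbox : InBox b := hb.1
  have hhalf : ∀ i ∈ range 7, 2 * b (i + 1) ≤ b 0 := hb.2.1
  have hp : 0 < p := by omega
  have h0 : 0 ≤ b 0 := hbox.1
  obtain ⟨j₁, hj₁, j₂, hj₂, hmin₁, hmin₂⟩ := exists_two_largest b
  have hj₁7 := mem_range.1 hj₁
  have hj₂7 := mem_range.1 (mem_erase.1 hj₂).2
  have hj₂1 : j₂ ≠ j₁ := (mem_erase.1 hj₂).1
  set C : ℕ := (classSet b p x).card with hCdef
  set R₁ := (range 7).erase j₁ with hR₁
  -- two poles ⇒ `nB j₂ ≥ 2`, `nB j₁ ≥ nB j₂`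
  obtain ⟨q₁, hq₁, q₂, hq₂, hqne⟩ := one_lt_card.1 (by unfold classPoleCount at hcount; omega :
    1 < ((classSet b p x).filter fun s => netExp b s < 0).card)
  rw [mem_filter] at hq₁ hq₂
  have hn2 : 2 ≤ nB b p x j₂ := by
    unfold nB
    refine one_lt_card.2 ⟨q₁, mem_filter.2 ⟨hq₁.1, ?_⟩, q₂, mem_filter.2 ⟨hq₂.1, ?_⟩, hqne⟩
    · exact mem_second_of_blockCount b hbox hj₂ hmin₂ (two_le_blockCount_of_pole b hq₁.2)
    · exact mem_second_of_blockCount b hbox hj₂ hmin₂ (two_le_blockCount_of_pole b hq₂.2)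
  have hn1 : nB b p x j₂ ≤ nB b p x j₁ := nB_mono b hbox p x hj₁7 hj₂7 (hmin₁ j₂ (mem_erase.1 hj₂).2)
  -- the per-block bounds of Lemma V1
  set bound : ℕ → ℤ := fun k => (if k = j₂ then 1 else pairTerm b p j₂ k) + pairTerm b p j₁ k with hbound_def
  have hbound : ∀ k ∈ R₁, (nB b p x k : ℤ) ≤ bound k := by
    intro k hk
    have hk7 := mem_range.1 (mem_erase.1 hk).2
    by_cases hkj : k = j₂
    · subst hkj
      simp only [hbound_def, ite_true]
      have hF1 := floorFact1 (x := x) b hb hp hj₁7 hk7 (by omega) (by omega)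
      have : (nB b p x k : ℤ) ≤ nB b p x j₁ := by exact_mod_cast hn1
      linarith
    · simp only [hbound_def, if_neg hkj]
      rcases Nat.eq_zero_or_pos (nB b p x k) with h0' | hpos
      · rw [h0']; push_cast
        linarith [pairTerm_nonneg b hb p hj₂7 hk7, pairTerm_nonneg b hb p hj₁7 hk7]
      · have hF2 := floorFact2 b hb hp hj₂7 hk7 (hmin₂ k hk) hpos
        have hF1 := floorFact1 (x := x) b hb hp hj₁7 hk7 (by omega) hpos
        have : (2 : ℤ) ≤ nB b p x j₁ := by exact_mod_cast le_trans hn2 hn1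
        have : (1 : ℤ) ≤ nB b p x k := by exact_mod_cast hpos
        linarith
  have hsplit : ∑ k ∈ R₁, bound k =
      1 + ∑ k ∈ R₁.erase j₂, pairTerm b p j₂ k + ∑ k ∈ R₁, pairTerm b p j₁ k := by
    simp only [hbound_def]
    rw [sum_add_distrib, ← add_sum_erase _ _ hj₂, if_pos rfl]
    congr 2
    exact sum_congr rfl fun k hk => by rw [if_neg (mem_erase.1 hk).1]
  have hstars := two_stars_le_pairFloors b hb p hj₁7 hj₂7 hj₂1
  have hle := sum_le_sum hbound
  have hCle : (nB b p x j₁ : ℤ) ≤ C := by exact_mod_cast (card_filter_le _ _ : nB b p x j₁ ≤ _)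
  have hEx := classExp_eq_card_sub b p x
  rw [← add_sum_erase _ _ hj₁] at hEx
  have hX1 : (0 : ℤ) ≤ (((classSet b p x).filter fun s : ℕ => 2 * (s : ℤ) = b 0).card : ℤ) := by positivity
  have hX2 : (0 : ℤ) ≤ (if ¬ (2 : ℤ) ∣ b 0 ∧ CentreIn b p x then 1 else 0) := by split_ifs <;> norm_num
  -- every link of the chain is tight
  have hT_C : (nB b p x j₁ : ℤ) = C := by linarith
  have hT_sum : ∑ k ∈ R₁, (nB b p x k : ℤ) = ∑ k ∈ R₁, bound k := by linarith
  have hT_X1 : (((classSet b p x).filter fun s : ℕ => 2 * (s : ℤ) = b 0).card : ℤ) = 0 := by linarith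
  have hT_X2 : (if ¬ (2 : ℤ) ∣ b 0 ∧ CentreIn b p x then (1 : ℤ) else 0) = 0 := by linarith
  have hT_stars : (∑ k ∈ R₁, pairTerm b p j₁ k) + ∑ k ∈ R₁.erase j₂, pairTerm b p j₂ k = pairFloors b p := by
    linarith
  have hT_k : ∀ k ∈ R₁, (nB b p x k : ℤ) = bound k := (sum_eq_sum_iff_of_le hbound).1 hT_sum
  -- the remaining pair floors vanish
  have hrest0 : pairSum b p (R₁.erase j₂) = 0 := by
    have h1 := pairSum_erase b p (mem_range.2 hj₁7 : j₁ ∈ range 7)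
    have h2 := pairSum_erase b p (mem_erase.2 ⟨hj₂1, mem_range.2 hj₂7⟩ : j₂ ∈ R₁)
    rw [pairSum_range, ← hR₁] at h1
    linarith
  have hrest : ∀ i ∈ R₁.erase j₂, ∀ k ∈ R₁.erase j₂, i ≠ k → pairTerm b p i k = 0 := by
    have hsub : R₁.erase j₂ ⊆ range 7 := (erase_subset _ _).trans (erase_subset _ _)
    have hnn' : ∀ i ∈ R₁.erase j₂, ∀ k ∈ R₁.erase j₂, 0 ≤ (if i < k then pairTerm b p i k else 0) :=
      fun i hi k hk => by
        split_ifs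
        · exact pairTerm_nonneg b hb p (mem_range.1 (hsub hi)) (mem_range.1 (hsub hk))
        · exact le_rfl
    have hrow := (sum_eq_zero_iff_of_nonneg fun i hi => sum_nonneg (hnn' i hi)).1 hrest0
    have hlt : ∀ i ∈ R₁.erase j₂, ∀ k ∈ R₁.erase j₂, i < k → pairTerm b p i k = 0 := by
      intro i hi k hk hik
      have := (sum_eq_zero_iff_of_nonneg (hnn' i hi)).1 (hrow i hi) k hk
      rwa [if_pos hik] at this
    intro i hi k hk hik
    rcases lt_or_gt_of_ne hik with h | h
    · exact hlt i hi k hk h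
    · rw [pairTerm_comm]; exact hlt k hk i hi h
  -- tightness at `j₂`: `nB j₁ = nB j₂ = C = N_{j₁j₂} + 1`
  have hj₂R : j₂ ∈ R₁ := hj₂
  have hT_j₂ : (nB b p x j₂ : ℤ) = 1 + pairTerm b p j₁ j₂ := by
    have := hT_k j₂ hj₂R; simp only [hbound_def, ite_true] at this; linarith
  have hF1_12 := floorFact1 (x := x) b hb hp hj₁7 hj₂7 (by omega) (by omega)
  have hn12 : (nB b p x j₁ : ℤ) = nB b p x j₂ := by
    have : (nB b p x j₂ : ℤ) ≤ nB b p x j₁ := by exact_mod_cast hn1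
    linarith
  have hC2 : (2 : ℤ) ≤ C := by
    have : (2 : ℤ) ≤ nB b p x j₂ := by exact_mod_cast hn2
    linarith
  have hCj₂ : (nB b p x j₂ : ℤ) = C := by linarith
  -- tightness at `k ∈ R₁ ∖ j₂`
  have hT_k' : ∀ k ∈ R₁.erase j₂, (nB b p x k : ℤ) = pairTerm b p j₂ k + pairTerm b p j₁ k := by
    intro k hk
    have hk' := mem_erase.1 hk
    have := hT_k k hk'.2
    simp only [hbound_def, if_neg hk'.1] at this
    exact this
  -- a met third block has `nB k = C = 2`, `N_{j₁k} = N_{j₂k} = 1`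
  have hthird : ∀ k ∈ R₁.erase j₂, 1 ≤ nB b p x k →
      (C : ℤ) = 2 ∧ (nB b p x k : ℤ) = 2 ∧ pairTerm b p j₁ k = 1 ∧ pairTerm b p j₂ k = 1 := by
    intro k hk hpos
    have hk' := mem_erase.1 hk
    have hk7 := mem_range.1 (mem_erase.1 hk'.2).2
    have hF2 := floorFact2 b hb hp hj₂7 hk7 (hmin₂ k hk'.2) hpos
    have hF1 := floorFact1 (x := x) b hb hp hj₁7 hk7 (by omega) hpos
    have hF1' := floorFact1 (x := x) b hb hp hj₂7 hk7 (by omega) hpos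
    have hmono : nB b p x k ≤ nB b p x j₂ := nB_mono b hbox p x hj₂7 hk7 (hmin₂ k hk'.2)
    have hmono' : (nB b p x k : ℤ) ≤ nB b p x j₂ := by exact_mod_cast hmono
    have hpos' : (1 : ℤ) ≤ nB b p x k := by exact_mod_cast hpos
    have heq := hT_k' k hk
    have hN1 : pairTerm b p j₁ k = 1 := by
      have : (1 : ℤ) ≤ pairTerm b p j₁ k := by linarith
      linarith
    exact ⟨by linarith, by linarith, hN1, by linarith⟩
  -- the block structure of the class points
  have hall₁ : ∀ q ∈ classSet b p x, q ∈ blk b j₁ :=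
    mem_blk_of_nB_eq_card b (by exact_mod_cast hT_C)
  have hall₂ : ∀ q ∈ classSet b p x, q ∈ blk b j₂ :=
    mem_blk_of_nB_eq_card b (by exact_mod_cast hCj₂)
  -- no even centre in the class, and no odd centre in the class
  have hnoEven : ∀ q ∈ classSet b p x, ¬ 2 * (q : ℤ) = b 0 := by
    intro q hq hc
    have hmem : q ∈ (classSet b p x).filter fun s : ℕ => 2 * (s : ℤ) = b 0 := mem_filter.2 ⟨hq, hc⟩
    have : 0 < ((classSet b p x).filter fun s : ℕ => 2 * (s : ℤ) = b 0).card := card_pos.2 ⟨q, hmem⟩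
    omega
  have hnoOdd : ¬ (¬ (2 : ℤ) ∣ b 0 ∧ CentreIn b p x) := by
    intro h; rw [if_pos h] at hT_X2; exact one_ne_zero hT_X2
  -- not self-conjugate
  have hx_mem : x ∈ classSet b p x := by
    unfold classSet
    refine mem_filter.2 ⟨mem_range.2 ?_, rfl⟩
    have : (x : ℤ) < b 0 + 1 := by linarith
    have hb0 : ((b 0).toNat : ℤ) = b 0 := Int.toNat_of_nonneg h0
    omega
  have hconj : conjClass b p x ≠ x := by
    intro hc
    unfold conjClass at hc
    have hb0 : ((b 0).toNat : ℤ) = b 0 := Int.toNat_of_nonneg h0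
    have hxle : x ≤ (b 0).toNat := by
      have : (x : ℤ) ≤ b 0 := by linarith
      omega
    -- `p ∣ b₀ − 2x`
    have hmod : ((b 0).toNat - x) % p = x % p := by rw [hc, Nat.mod_eq_of_lt hx]
    have hdvd : (p : ℤ) ∣ (((b 0).toNat - x : ℕ) : ℤ) - x := (Nat.modEq_iff_dvd.1 hmod.symm)
    have hdvd' : (p : ℤ) ∣ 2 * (x : ℤ) - b 0 := by
      have e : (2 * (x : ℤ) - b 0) = -((((b 0).toNat - x : ℕ) : ℤ) - x) := by
        push_cast [Nat.cast_sub hxle]; omega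
      rw [e]; exact hdvd.neg_right
    have hcen : CentreIn b p x := hdvd'
    by_cases hev : (2 : ℤ) ∣ b 0
    · -- even `b₀`: the centre `b₀/2` is a class point, an even centre
      obtain ⟨c, hc2⟩ := hev
      have hc0 : 0 ≤ c := by linarith
      have hpc : (p : ℤ) ∣ (c.toNat : ℤ) - x := by
        rw [Int.toNat_of_nonneg hc0]
        have h2 : (p : ℤ) ∣ 2 * ((x : ℤ) - c) := by
          have e : 2 * ((x : ℤ) - c) = 2 * (x : ℤ) - b 0 := by rw [hc2]; ring
          rw [e]; exact hdvd'
        have hcop : IsCoprime (p : ℤ) 2 := by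
          rw [Int.isCoprime_iff_gcd_eq_one]
          have hodd' : ¬ 2 ∣ p := hodd
          have : Nat.gcd p 2 = 1 := by
            have := Nat.Coprime.gcd_eq_one (Nat.Coprime.symm ((Nat.Prime.coprime_iff_not_dvd Nat.prime_two).2 hodd'))
            exact this
          simpa [Int.gcd] using this
        have := hcop.dvd_of_dvd_mul_left h2
        rw [dvd_sub_comm] at this
        exact this
      have hcmem : c.toNat ∈ classSet b p x := by
        unfold classSet
        refine mem_filter.2 ⟨mem_range.2 ?_, ?_⟩
        · have : c ≤ b 0 := by linarith
          have e1 : ((c.toNat : ℕ) : ℤ) = c := Int.toNat_of_nonneg hc0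
          omega
        · exact ((Nat.modEq_iff_dvd.2 hpc) : x ≡ c.toNat [MOD p]).symm
      exact hnoEven _ hcmem (by rw [Int.toNat_of_nonneg hc0]; linarith)
    · exact hnoOdd ⟨hev, hcen⟩
  -- the two cases: a third met block or not
  by_cases hK : ∃ k ∈ R₁.erase j₂, 1 ≤ nB b p x k
  · -- CASE B: a third met block `k₃` — two double poles, `N_p = 3`
    obtain ⟨k₃, hk₃, hk₃pos⟩ := hK
    obtain ⟨hC2', hnk₃, hN13, hN23⟩ := hthird k₃ hk₃ hk₃pos
    have hk₃' := mem_erase.1 hk₃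
    have hk₃7 := mem_range.1 (mem_erase.1 hk₃'.2).2
    -- no fourth met block
    have hothers : ∀ k ∈ (R₁.erase j₂).erase k₃, nB b p x k = 0 := by
      intro k hk
      have hk' := mem_erase.1 hk
      by_contra hne
      have hkpos : 1 ≤ nB b p x k := by omega
      obtain ⟨-, hnk, -, -⟩ := hthird k hk'.2 hkpos
      have hk7 := mem_range.1 (mem_erase.1 (mem_erase.1 hk'.2).2).2
      have hF1 := floorFact1 (x := x) b hb hp hk7 hk₃7 hkpos hk₃pos
      have h0' := hrest k hk'.2 k₃ hk₃ hk'.1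
      linarith
    have hothersN : ∀ k ∈ (R₁.erase j₂).erase k₃, pairTerm b p j₁ k = 0 ∧ pairTerm b p j₂ k = 0 := by
      intro k hk
      have hk' := mem_erase.1 hk
      have hk7 := mem_range.1 (mem_erase.1 (mem_erase.1 hk'.2).2).2
      have heq := hT_k' k hk'.2
      rw [hothers k hk] at heq
      push_cast at heq
      constructor <;> linarith [pairTerm_nonneg b hb p hj₁7 hk7, pairTerm_nonneg b hb p hj₂7 hk7]
    -- `N_p = 3`
    have hN12 : pairTerm b p j₁ j₂ = 1 := by linarith
    have hNp : pairFloors b p = 3 := by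
      rw [← hT_stars, ← add_sum_erase _ _ hj₂R, ← add_sum_erase _ _ hk₃, ← add_sum_erase _ _ hk₃,
        sum_eq_zero (fun k hk => (hothersN k hk).1), sum_eq_zero (fun k hk => (hothersN k hk).2), hN12, hN13, hN23]
      norm_num
    -- every class point has depth exactly 3
    have hnk₃C : nB b p x k₃ = C := by
      have : (nB b p x k₃ : ℤ) = C := by linarith
      exact_mod_cast this
    have hall₃ : ∀ q ∈ classSet b p x, q ∈ blk b k₃ := mem_blk_of_nB_eq_card b hnk₃C
    have hdepth : ∀ q ∈ classSet b p x, blockCount b q = 3 := by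
      intro q hq
      rw [blockCount_eq]
      have hset : (range 7).filter (fun j => q ∈ blk b j) = insert k₃ {j₁, j₂} := by
        ext k
        simp only [mem_filter, mem_insert, mem_singleton, mem_range]
        constructor
        · rintro ⟨hk7, hqk⟩
          by_contra hne
          push Not at hne
          have hkmem : k ∈ (R₁.erase j₂).erase k₃ :=
            mem_erase.2 ⟨hne.1, mem_erase.2 ⟨hne.2.2, mem_erase.2 ⟨hne.2.1, mem_range.2 hk7⟩⟩⟩
          exact not_mem_blk_of_nB_eq_zero b (hothers k hkmem) q hq hqk
        · rintro (rfl | rfl | rfl)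
          · exact ⟨hk₃7, hall₃ q hq⟩
          · exact ⟨hj₁7, hall₁ q hq⟩
          · exact ⟨hj₂7, hall₂ q hq⟩
      rw [hset, card_insert_of_notMem, card_pair hj₂1.symm]
      simp only [mem_insert, mem_singleton, not_or]
      exact ⟨(mem_erase.1 hk₃'.2).1, hk₃'.1⟩
    refine ⟨?_, hconj, Or.inr ⟨hNp, fun q hq => ?_⟩⟩
    · have : (C : ℤ) = 2 := hC2'
      exact_mod_cast this
    · unfold netExp
      rw [hdepth q hq, if_neg (hnoEven q hq)]
      norm_num
  · -- CASE A: no third met block — two simple poles, `N_p = 1`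
    push Not at hK
    have hzero : ∀ k ∈ R₁.erase j₂, nB b p x k = 0 := fun k hk => by have := hK k hk; omega
    have hzeroN : ∀ k ∈ R₁.erase j₂, pairTerm b p j₁ k = 0 ∧ pairTerm b p j₂ k = 0 := by
      intro k hk
      have hk' := mem_erase.1 hk
      have hk7 := mem_range.1 (mem_erase.1 hk'.2).2
      have heq := hT_k' k hk
      rw [hzero k hk] at heq
      push_cast at heq
      constructor <;> linarith [pairTerm_nonneg b hb p hj₁7 hk7, pairTerm_nonneg b hb p hj₂7 hk7]
    have hNp : pairFloors b p = pairTerm b p j₁ j₂ := by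
      rw [← hT_stars, ← add_sum_erase _ _ hj₂R, sum_eq_zero (fun k hk => (hzeroN k hk).1),
        sum_eq_zero (fun k hk => (hzeroN k hk).2)]
      ring
    -- a third index with vanishing pair floor bounds the span of the class
    have hne5 : (R₁.erase j₂).Nonempty := by
      rw [← card_pos, card_erase_of_mem hj₂R, hR₁, card_erase_of_mem hj₁, card_range]; norm_num
    obtain ⟨j₃, hj₃⟩ := hne5
    have hj₃7 := mem_range.1 (mem_erase.1 (mem_erase.1 hj₃).2).2
    have hN13 : pairTerm b p j₁ j₃ = 0 := (hzeroN j₃ hj₃).1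
    have hspan_lt : b 0 - 2 * b (j₁ + 1) < 2 * (p : ℤ) := by
      have h3 := hhalf j₃ (mem_range.2 hj₃7)
      have hlt := lt_of_ediv_eq_zero hp (by unfold pairTerm at hN13; exact hN13)
      linarith
    -- span of the class inside `B_{j₁}`
    have hCle2 : (C : ℤ) ≤ 2 := by
      have hne : (classSet b p x).Nonempty := card_pos.1 (by omega)
      have hsp := card_mul_le_span b hp (classSet b p x) subset_rfl hne
      have hM := (mem_blk b j₁ _).1 (hall₁ _ (max'_mem _ hne))
      have hm := (mem_blk b j₁ _).1 (hall₁ _ (min'_mem _ hne))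
      have hβ : 0 ≤ b (j₁ + 1) := (hbox.2 j₁ (mem_range.2 hj₁7)).1
      have hβle : b (j₁ + 1) ≤ b 0 := by have := hhalf j₁ (mem_range.2 hj₁7); linarith
      have e0 : (((b 0).toNat : ℕ) : ℤ) = b 0 := Int.toNat_of_nonneg h0
      have e1 : (((b (j₁ + 1)).toNat : ℕ) : ℤ) = b (j₁ + 1) := Int.toNat_of_nonneg hβ
      have hdiff : ((classSet b p x).max' hne : ℤ) - ((classSet b p x).min' hne : ℤ) ≤ b 0 - 2 * b (j₁ + 1) := by
        omega
      have h1 : (p : ℤ) * ((C : ℤ) - 1) < (p : ℤ) * 2 := by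
        calc (p : ℤ) * ((C : ℤ) - 1) ≤ _ := hsp
          _ ≤ b 0 - 2 * b (j₁ + 1) := hdiff
          _ < 2 * (p : ℤ) := hspan_lt
          _ = (p : ℤ) * 2 := by ring
      have := lt_of_mul_lt_mul_left h1 (by positivity)
      linarith
    have hC2' : (C : ℤ) = 2 := le_antisymm hCle2 hC2
    have hNp1 : pairFloors b p = 1 := by rw [hNp]; linarith
    -- every class point has depth exactly 2
    have hdepth : ∀ q ∈ classSet b p x, blockCount b q = 2 := by
      intro q hq
      rw [blockCount_eq]
      have hset : (range 7).filter (fun j => q ∈ blk b j) = {j₁, j₂} := by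
        ext k
        simp only [mem_filter, mem_insert, mem_singleton, mem_range]
        constructor
        · rintro ⟨hk7, hqk⟩
          by_contra hne
          push Not at hne
          have hkmem : k ∈ R₁.erase j₂ := mem_erase.2 ⟨hne.2, mem_erase.2 ⟨hne.1, mem_range.2 hk7⟩⟩
          exact not_mem_blk_of_nB_eq_zero b (hzero k hkmem) q hq hqk
        · rintro (rfl | rfl)
          · exact ⟨hj₁7, hall₁ q hq⟩
          · exact ⟨hj₂7, hall₂ q hq⟩
      rw [hset, card_pair hj₂1.symm]
    refine ⟨?_, hconj, Or.inl ⟨hNp1, fun q hq => ?_⟩⟩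
    · exact_mod_cast hC2'
    · unfold netExp
      rw [hdepth q hq, if_neg (hnoEven q hq)]
      norm_num

end Summit.KontsevichZagierPeriods.Zeta5Search.ClusterValuation

end
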